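import Summits.KontsevichZagierPeriods.Zeta5Search.Certificates.VIMLevel2NKKey3
import HarnessLib

/-!
# ζ(5) search — brown9 LEVEL 2 (R-NK), key: level-1 reduction to the basis `(T(n;p,q), T(n;p+1,q))` and the assembly (cell `pub-zeta5`, certifier `cert-1`)

HONEST FRAMING: systematic search; no irrationality claim unless certified.

The termwise identity behind the ttrl2 lane's R-NK certificate (`r1c/R_NK.json`; see `Certificates/VIMLevel2NKData.lean`)
involves the 13 inner-block values `U = T(n+1;p+3,q+2)` and `T(n;p+i,q+j)` (`p = 3n−x−k`, `q = 2n−k`, `x = k₃`, `k = k₅`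
rational parameters). Here every one of them is expressed in the basis `T(n;p,q), T(n;p+1,q)` of the certified rank-2 module
(`coord_*`: `d·Y = c₀·T(n;p,q) + c₁·T(n;p+1,q)` with small REDUCED polynomial coordinates, re-derived in the seat —
`HOME/cert-1/g2/py/nk_coords2.py`) from eleven level-1 relation instances (P2 ×4, M3 ×3, M4 ×3, N1; `Certificates/VIMInnerModule(N)`),
each step being a small linear combination over OPAQUE polynomial values `peval e [n,x,k]` whose polynomial bookkeeping is
checked by the kernel (`PolyReflect.peval_eq_of_kron`, one integer evaluation each). `NK_key` then assembles: multiplying the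
cleared termwise combination `KEYPOLY` by `L` and substituting coordinates leaves `gcd₀·FIN0·T(n;p,q) + gcd₁·FIN1·T(n;p+1,q)`,
so the two kernel-checked coordinate identities `fin0/fin1` give `KEYPOLY = 0` on the region `x < 0`, `0 ≤ k ≤ n−1`, `n ≥ 2`
(where all cancelled leading coefficients are nonzero). No named facts.

Part 4: coordinates of the remaining atoms (continued). (File 4 of 4.)
-/

noncomputable section

namespace Summit.KontsevichZagierPeriods.Zeta5Search.Certificates

namespace VIMInner.NK

open PolyReflect
open Lean.Grind.CommRing (Expr)

/-- **Coordinates of `T n ((3 * (n : ℚ) - x - k) - 1) ((2 * (n : ℚ) - k) - 1)`** (from Cm1m1): `d·Y = c₀·T(n;p,q) + c₁·T(n;p+1,q)`. -/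
theorem coord_Tm1m1 (n : ℕ) (hn : 2 ≤ n) (x k : ℚ) (hx : x < 0) (hk0 : 0 ≤ k) (hk : k + 1 ≤ (n : ℚ)) :
    peval eD_Tm1m1 [(n : ℚ), x, k] * T n ((3 * (n : ℚ) - x - k) - 1) ((2 * (n : ℚ) - k) - 1)
      = peval eC0_Tm1m1 [(n : ℚ), x, k] * T n (3 * (n : ℚ) - x - k) (2 * (n : ℚ) - k) + peval eC1_Tm1m1 [(n : ℚ), x, k] * T n ((3 * (n : ℚ) - x - k) + 1) (2 * (n : ℚ) - k) := by
  have hn' : (2 : ℚ) ≤ n := by exact_mod_cast hn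
  have d0 : pvar [(n : ℚ), x, k] 0 = (n : ℚ) := rfl
  have d1 : pvar [(n : ℚ), x, k] 1 = x := rfl
  have hrel := relCmm n hn x k
  have cTm10 := coord_Tm10 n hn x k hx hk0 hk
  have kd := peval_eq_of_kron (Expr.mul eG_Tm1m1 eD_Tm1m1) (Expr.mul eRCmm_Tm1m1 eLd_Tm1m1) (by decide +kernel)
    (by decide +kernel) (n : ℚ) x k
  have k0 := peval_eq_of_kron (Expr.mul eG_Tm1m1 eC0_Tm1m1)
    (Expr.add (Expr.neg (Expr.mul eRCmm_Tm10 (Expr.mul eLq_Tm1m1_Tm10 eC0_Tm10))) (Expr.neg (Expr.mul eRCmm_T00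
    eLd_Tm1m1))) (by decide +kernel) (by decide +kernel) (n : ℚ) x k
  have k1 := peval_eq_of_kron (Expr.mul eG_Tm1m1 eC1_Tm1m1)
    (Expr.neg (Expr.mul eRCmm_Tm10 (Expr.mul eLq_Tm1m1_Tm10 eC1_Tm10))) (by decide +kernel) (by decide +kernel) (n : ℚ) x k
  have klTm10 := peval_eq_of_kron (Expr.mul eLq_Tm1m1_Tm10 eD_Tm10) eLd_Tm1m1 (by decide +kernel) (by decide +kernel) (n : ℚ) x k
  simp only [peval_add, peval_neg, peval_mul] at kd k0 k1 klTm10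
  have hG : peval eG_Tm1m1 [(n : ℚ), x, k] ≠ 0 := by
    simp only [eG_Tm1m1, peval_add, peval_neg, peval_mul, peval_num, peval_var, d0, d1]
    push_cast
    exact (mul_ne_zero (ne_of_lt (by linarith)) (mul_ne_zero (ne_of_lt (by linarith)) (ne_of_lt (by linarith))))
  apply mul_left_cancel₀ hG
  linear_combination T n ((3 * (n : ℚ) - x - k) - 1) ((2 * (n : ℚ) - k) - 1) * kd + peval eLd_Tm1m1 [(n : ℚ), x, k] * hrel - T n
    (3 * (n : ℚ) - x - k) (2 * (n : ℚ) - k) * k0 - T n ((3 * (n : ℚ) - x - k) + 1) (2 * (n : ℚ) - k) * k1 +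
    (-(peval eRCmm_Tm10 [(n : ℚ), x, k]) * peval eLq_Tm1m1_Tm10 [(n : ℚ), x, k]) * cTm10 + ((peval
    eRCmm_Tm10 [(n : ℚ), x, k]) * T n ((3 * (n : ℚ) - x - k) - 1) (2 * (n : ℚ) - k)) * klTm10

/-- Cancelled factor `g` of the coordinate step for `T n (3 * (n : ℚ) - x - k) ((2 * (n : ℚ) - k) - 1)`: `x*(-2*w + x)*(k - 2*w + x)`. -/
def eG_T0m1 : Expr :=
  (Expr.mul (Expr.var 1) (Expr.mul (Expr.add (Expr.mul (Expr.num (-2)) (Expr.var 0)) (Expr.var 1)) (Expr.add (Expr.add (Expr.mul (Expr.num (-2)) (Expr.var 0)) (Expr.var 1)) (Expr.var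
  2))))

/-- Common denominator of the step for `T n (3 * (n : ℚ) - x - k) ((2 * (n : ℚ) - k) - 1)`: `(k - w)*(-2*w + x)*(k - 2*w + x)`. -/
def eLd_T0m1 : Expr :=
  (Expr.mul (Expr.num (-1)) (Expr.mul (Expr.add (Expr.var 0) (Expr.neg (Expr.var 2))) (Expr.mul (Expr.add (Expr.mul (Expr.num (-2)) (Expr.var 0)) (Expr.var 1)) (Expr.add (Expr.add
  (Expr.mul (Expr.num (-2)) (Expr.var 0)) (Expr.var 1)) (Expr.var 2)))))

/-- Cofactor `L/d` of `T n ((3 * (n : ℚ) - x - k) - 1) ((2 * (n : ℚ) - k) - 1)` in the step for `T n (3 * (n : ℚ) - x - k) ((2 * (n : ℚ) - k) - 1)`: `-2*w + x`. -/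
def eLq_T0m1_Tm1m1 : Expr :=
  (Expr.add (Expr.mul (Expr.num (-2)) (Expr.var 0)) (Expr.var 1))

/-- Cofactor `L/d` of `T n ((3 * (n : ℚ) - x - k) - 1) (2 * (n : ℚ) - k)` in the step for `T n (3 * (n : ℚ) - x - k) ((2 * (n : ℚ) - k) - 1)`: `k - w`. -/
def eLq_T0m1_Tm10 : Expr :=
  (Expr.add (Expr.neg (Expr.var 0)) (Expr.var 2))

/-- **Coordinates of `T n (3 * (n : ℚ) - x - k) ((2 * (n : ℚ) - k) - 1)`** (from M4(-1,-1)): `d·Y = c₀·T(n;p,q) + c₁·T(n;p+1,q)`. -/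
theorem coord_T0m1 (n : ℕ) (hn : 2 ≤ n) (x k : ℚ) (hx : x < 0) (hk0 : 0 ≤ k) (hk : k + 1 ≤ (n : ℚ)) :
    peval eD_T0m1 [(n : ℚ), x, k] * T n (3 * (n : ℚ) - x - k) ((2 * (n : ℚ) - k) - 1)
      = peval eC0_T0m1 [(n : ℚ), x, k] * T n (3 * (n : ℚ) - x - k) (2 * (n : ℚ) - k) + peval eC1_T0m1 [(n : ℚ), x, k] * T n ((3 * (n : ℚ) - x - k) + 1) (2 * (n : ℚ) - k) := by
  have hn' : (2 : ℚ) ≤ n := by exact_mod_cast hn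
  have d0 : pvar [(n : ℚ), x, k] 0 = (n : ℚ) := rfl
  have d1 : pvar [(n : ℚ), x, k] 1 = x := rfl
  have d2 : pvar [(n : ℚ), x, k] 2 = k := rfl
  have hrel := relM4m n hn x k
  have cTm1m1 := coord_Tm1m1 n hn x k hx hk0 hk
  have cTm10 := coord_Tm10 n hn x k hx hk0 hk
  have kd := peval_eq_of_kron (Expr.mul eG_T0m1 eD_T0m1) (Expr.mul eRM4m_T0m1 eLd_T0m1) (by decide +kernel)
    (by decide +kernel) (n : ℚ) x k
  have k0 := peval_eq_of_kron (Expr.mul eG_T0m1 eC0_T0m1)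
    (Expr.add (Expr.add (Expr.neg (Expr.mul eRM4m_Tm1m1 (Expr.mul eLq_T0m1_Tm1m1 eC0_Tm1m1))) (Expr.neg (Expr.mul
    eRM4m_Tm10 (Expr.mul eLq_T0m1_Tm10 eC0_Tm10)))) (Expr.neg (Expr.mul eRM4m_T00 eLd_T0m1))) (by decide +kernel) (by decide +kernel) (n : ℚ) x k
  have k1 := peval_eq_of_kron (Expr.mul eG_T0m1 eC1_T0m1)
    (Expr.add (Expr.neg (Expr.mul eRM4m_Tm1m1 (Expr.mul eLq_T0m1_Tm1m1 eC1_Tm1m1))) (Expr.neg (Expr.mul eRM4m_Tm10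
    (Expr.mul eLq_T0m1_Tm10 eC1_Tm10)))) (by decide +kernel) (by decide +kernel) (n : ℚ) x k
  have klTm1m1 := peval_eq_of_kron (Expr.mul eLq_T0m1_Tm1m1 eD_Tm1m1) eLd_T0m1 (by decide +kernel) (by decide +kernel) (n : ℚ) x k
  have klTm10 := peval_eq_of_kron (Expr.mul eLq_T0m1_Tm10 eD_Tm10) eLd_T0m1 (by decide +kernel) (by decide +kernel) (n : ℚ) x k
  simp only [peval_add, peval_neg, peval_mul] at kd k0 k1 klTm1m1 klTm10
  have hG : peval eG_T0m1 [(n : ℚ), x, k] ≠ 0 := by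
    simp only [eG_T0m1, peval_add, peval_mul, peval_num, peval_var, d0, d1, d2]
    push_cast
    exact (mul_ne_zero (ne_of_lt (by linarith)) (mul_ne_zero (ne_of_lt (by linarith)) (ne_of_lt (by linarith))))
  apply mul_left_cancel₀ hG
  linear_combination T n (3 * (n : ℚ) - x - k) ((2 * (n : ℚ) - k) - 1) * kd + peval eLd_T0m1 [(n : ℚ), x, k] * hrel - T n (3 * (n
    : ℚ) - x - k) (2 * (n : ℚ) - k) * k0 - T n ((3 * (n : ℚ) - x - k) + 1) (2 * (n : ℚ) - k) * k1 + (-(peval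
    eRM4m_Tm1m1 [(n : ℚ), x, k]) * peval eLq_T0m1_Tm1m1 [(n : ℚ), x, k]) * cTm1m1 + ((peval eRM4m_Tm1m1 [(n
    : ℚ), x, k]) * T n ((3 * (n : ℚ) - x - k) - 1) ((2 * (n : ℚ) - k) - 1)) * klTm1m1 + (-(peval eRM4m_Tm10
    [(n : ℚ), x, k]) * peval eLq_T0m1_Tm10 [(n : ℚ), x, k]) * cTm10 + ((peval eRM4m_Tm10 [(n : ℚ), x, k]) *
    T n ((3 * (n : ℚ) - x - k) - 1) (2 * (n : ℚ) - k)) * klTm10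

/-! ### Assembly: `KEYPOLY = 0` from the two coordinate identities -/

/-- Coefficient (× `E10` × atom) of the cleared termwise combination KEYPOLY: `-(-k + w)*(-k + w + 1)*(k - 3*w + x)*(k - 3*w + x - 3)*(k - 3*w + x - 2)*(k - 3*w + x - 1)*(k - 3*w + x + 1)*(k - 2*w + x - 2)*(k - 2*w + x - 1)`. -/
def eK_U : Expr :=
  (Expr.mul (Expr.num (-1)) (Expr.mul (Expr.add (Expr.var 0) (Expr.neg (Expr.var 2))) (Expr.mul (Expr.add
  (Expr.add (Expr.var 0) (Expr.neg (Expr.var 2))) (Expr.num 1)) (Expr.mul (Expr.add (Expr.add (Expr.mul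
  (Expr.num (-3)) (Expr.var 0)) (Expr.var 1)) (Expr.var 2)) (Expr.mul (Expr.add (Expr.add (Expr.add (Expr.mul
  (Expr.num (-3)) (Expr.var 0)) (Expr.var 1)) (Expr.var 2)) (Expr.num 1)) (Expr.mul (Expr.add (Expr.add
  (Expr.add (Expr.mul (Expr.num (-3)) (Expr.var 0)) (Expr.var 1)) (Expr.var 2)) (Expr.num (-1))) (Expr.mul
  (Expr.add (Expr.add (Expr.add (Expr.mul (Expr.num (-2)) (Expr.var 0)) (Expr.var 1)) (Expr.var 2)) (Expr.num
  (-1))) (Expr.mul (Expr.add (Expr.add (Expr.add (Expr.mul (Expr.num (-3)) (Expr.var 0)) (Expr.var 1)) (Expr.var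
  2)) (Expr.num (-3))) (Expr.mul (Expr.add (Expr.add (Expr.add (Expr.mul (Expr.num (-3)) (Expr.var 0)) (Expr.var
  1)) (Expr.var 2)) (Expr.num (-2))) (Expr.add (Expr.add (Expr.add (Expr.mul (Expr.num (-2)) (Expr.var 0))
  (Expr.var 1)) (Expr.var 2)) (Expr.num (-2))))))))))))

/-- Coefficient (× `E00` × atom) of the cleared termwise combination KEYPOLY: `(-k + w)*(-k + w + 1)**2*(k - 3*w + x)*(k - 3*w + x + 1)*(k - 2*w + x - 2)**2*(k - 2*w + x - 1)**2`. -/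
def eK_T00e : Expr :=
  (Expr.mul (Expr.add (Expr.add (Expr.var 0) (Expr.neg (Expr.var 2))) (Expr.num 1)) (Expr.mul (Expr.add (Expr.add
  (Expr.var 0) (Expr.neg (Expr.var 2))) (Expr.num 1)) (Expr.mul (Expr.add (Expr.add (Expr.add (Expr.mul
  (Expr.num (-2)) (Expr.var 0)) (Expr.var 1)) (Expr.var 2)) (Expr.num (-1))) (Expr.mul (Expr.add (Expr.add
  (Expr.add (Expr.mul (Expr.num (-2)) (Expr.var 0)) (Expr.var 1)) (Expr.var 2)) (Expr.num (-1))) (Expr.mul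
  (Expr.add (Expr.add (Expr.add (Expr.mul (Expr.num (-2)) (Expr.var 0)) (Expr.var 1)) (Expr.var 2)) (Expr.num
  (-2))) (Expr.mul (Expr.add (Expr.add (Expr.add (Expr.mul (Expr.num (-2)) (Expr.var 0)) (Expr.var 1)) (Expr.var
  2)) (Expr.num (-2))) (Expr.mul (Expr.add (Expr.var 0) (Expr.neg (Expr.var 2))) (Expr.mul (Expr.add (Expr.add
  (Expr.mul (Expr.num (-3)) (Expr.var 0)) (Expr.var 1)) (Expr.var 2)) (Expr.add (Expr.add (Expr.add (Expr.mul
  (Expr.num (-3)) (Expr.var 0)) (Expr.var 1)) (Expr.var 2)) (Expr.num 1))))))))))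

/-- Coefficient (× `E01` × atom) of the cleared termwise combination KEYPOLY: `(-k + w)*(-k + w + 1)**2*(k - 2*w + x)*(k - 3*w + x + 1)*(k - 2*w + x - 2)**2*(k - 2*w + x - 1)**2`. -/
def eK_Tm1 : Expr :=
  (Expr.mul (Expr.add (Expr.add (Expr.var 0) (Expr.neg (Expr.var 2))) (Expr.num 1)) (Expr.mul (Expr.add (Expr.add
  (Expr.var 0) (Expr.neg (Expr.var 2))) (Expr.num 1)) (Expr.mul (Expr.add (Expr.add (Expr.add (Expr.mul
  (Expr.num (-2)) (Expr.var 0)) (Expr.var 1)) (Expr.var 2)) (Expr.num (-1))) (Expr.mul (Expr.add (Expr.add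
  (Expr.add (Expr.mul (Expr.num (-2)) (Expr.var 0)) (Expr.var 1)) (Expr.var 2)) (Expr.num (-1))) (Expr.mul
  (Expr.add (Expr.add (Expr.add (Expr.mul (Expr.num (-2)) (Expr.var 0)) (Expr.var 1)) (Expr.var 2)) (Expr.num
  (-2))) (Expr.mul (Expr.add (Expr.add (Expr.add (Expr.mul (Expr.num (-2)) (Expr.var 0)) (Expr.var 1)) (Expr.var
  2)) (Expr.num (-2))) (Expr.mul (Expr.add (Expr.var 0) (Expr.neg (Expr.var 2))) (Expr.mul (Expr.add (Expr.add
  (Expr.mul (Expr.num (-2)) (Expr.var 0)) (Expr.var 1)) (Expr.var 2)) (Expr.add (Expr.add (Expr.add (Expr.mul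
  (Expr.num (-3)) (Expr.var 0)) (Expr.var 1)) (Expr.var 2)) (Expr.num 1))))))))))

/-- Coefficient (× `S0p` × atom) of the cleared termwise combination KEYPOLY: `(-k + w + 1)**2*(k - 2*w + x - 2)**2`. -/
def eK_Tmm : Expr :=
  (Expr.mul (Expr.add (Expr.add (Expr.var 0) (Expr.neg (Expr.var 2))) (Expr.num 1)) (Expr.mul (Expr.add (Expr.add
  (Expr.var 0) (Expr.neg (Expr.var 2))) (Expr.num 1)) (Expr.mul (Expr.add (Expr.add (Expr.add (Expr.mul
  (Expr.num (-2)) (Expr.var 0)) (Expr.var 1)) (Expr.var 2)) (Expr.num (-2))) (Expr.add (Expr.add (Expr.add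
  (Expr.mul (Expr.num (-2)) (Expr.var 0)) (Expr.var 1)) (Expr.var 2)) (Expr.num (-2))))))

/-- Coefficient (× `S1p` × atom) of the cleared termwise combination KEYPOLY: `(-k + w + 1)**2*(k - 2*w + x - 2)**2`. -/
def eK_Tzm : Expr :=
  (Expr.mul (Expr.add (Expr.add (Expr.var 0) (Expr.neg (Expr.var 2))) (Expr.num 1)) (Expr.mul (Expr.add (Expr.add
  (Expr.var 0) (Expr.neg (Expr.var 2))) (Expr.num 1)) (Expr.mul (Expr.add (Expr.add (Expr.add (Expr.mul
  (Expr.num (-2)) (Expr.var 0)) (Expr.var 1)) (Expr.var 2)) (Expr.num (-2))) (Expr.add (Expr.add (Expr.add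
  (Expr.mul (Expr.num (-2)) (Expr.var 0)) (Expr.var 1)) (Expr.var 2)) (Expr.num (-2))))))

/-- Coefficient (× `S0` × atom) of the cleared termwise combination KEYPOLY: `k*(-k + w)*(k - 3*w + x + 1)*(k - 2*w + x - 1)`. -/
def eK_S0t : Expr :=
  (Expr.mul (Expr.var 2) (Expr.mul (Expr.add (Expr.var 0) (Expr.neg (Expr.var 2))) (Expr.mul (Expr.add (Expr.add
  (Expr.add (Expr.mul (Expr.num (-3)) (Expr.var 0)) (Expr.var 1)) (Expr.var 2)) (Expr.num 1)) (Expr.add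
  (Expr.add (Expr.add (Expr.mul (Expr.num (-2)) (Expr.var 0)) (Expr.var 1)) (Expr.var 2)) (Expr.num (-1))))))

/-- Coefficient (× `S1` × atom) of the cleared termwise combination KEYPOLY: `k*(-k + w)*(k - 3*w + x + 1)*(k - 2*w + x - 1)`. -/
def eK_S1t : Expr :=
  (Expr.mul (Expr.var 2) (Expr.mul (Expr.add (Expr.var 0) (Expr.neg (Expr.var 2))) (Expr.mul (Expr.add (Expr.add
  (Expr.add (Expr.mul (Expr.num (-3)) (Expr.var 0)) (Expr.var 1)) (Expr.var 2)) (Expr.num 1)) (Expr.add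
  (Expr.add (Expr.add (Expr.mul (Expr.num (-2)) (Expr.var 0)) (Expr.var 1)) (Expr.var 2)) (Expr.num (-1))))))

/-- The common multiplier `L` (lcm of the coordinate denominators of `U, T(p−1,q), T(p−1,q−1), T(p,q−1)`): `(-k + w)*(-2*w + x)*(w + 1)**2*(-k + w + 1)*(k - 2*w + x)*(k - 2*w + x - 2)`. -/
def eL_NK : Expr :=
  (Expr.mul (Expr.add (Expr.var 0) (Expr.num 1)) (Expr.mul (Expr.add (Expr.var 0) (Expr.num 1)) (Expr.mul
  (Expr.add (Expr.var 0) (Expr.neg (Expr.var 2))) (Expr.mul (Expr.add (Expr.mul (Expr.num (-2)) (Expr.var 0))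
  (Expr.var 1)) (Expr.mul (Expr.add (Expr.add (Expr.var 0) (Expr.neg (Expr.var 2))) (Expr.num 1)) (Expr.mul
  (Expr.add (Expr.add (Expr.mul (Expr.num (-2)) (Expr.var 0)) (Expr.var 1)) (Expr.var 2)) (Expr.add (Expr.add
  (Expr.add (Expr.mul (Expr.num (-2)) (Expr.var 0)) (Expr.var 1)) (Expr.var 2)) (Expr.num (-2)))))))))

/-- `gcd₀ = (-k + w + 1)*(k - 2*w + x - 2)` (factor removed from coordinate identity 0). -/
def eGcd0 : Expr :=
  (Expr.mul (Expr.add (Expr.add (Expr.var 0) (Expr.neg (Expr.var 2))) (Expr.num 1)) (Expr.add (Expr.add (Expr.add (Expr.mul (Expr.num (-2)) (Expr.var 0)) (Expr.var 1)) (Expr.var 2)) (Expr.num (-2))))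

/-- `gcd₁ = (-k + w + 1)*(k - 2*w + x - 2)*(k - 2*w + x - 1)` (factor removed from coordinate identity 1). -/
def eGcd1 : Expr :=
  (Expr.mul (Expr.add (Expr.add (Expr.var 0) (Expr.neg (Expr.var 2))) (Expr.num 1)) (Expr.mul (Expr.add (Expr.add (Expr.add (Expr.mul (Expr.num (-2)) (Expr.var 0)) (Expr.var 1)) (Expr.var 2)) (Expr.num (-1))) (Expr.add (Expr.add (Expr.add (Expr.mul (Expr.num (-2)) (Expr.var 0)) (Expr.var 1)) (Expr.var 2)) (Expr.num (-2)))))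

/-- `L / d` for the atom of KEYPOLY term `U`. -/
def eLq_U : Expr :=
  (Expr.mul (Expr.add (Expr.var 0) (Expr.neg (Expr.var 2))) (Expr.mul (Expr.add (Expr.mul (Expr.num (-2))
  (Expr.var 0)) (Expr.var 1)) (Expr.add (Expr.add (Expr.mul (Expr.num (-2)) (Expr.var 0)) (Expr.var 1))
  (Expr.var 2))))

/-- `L / d` for the atom of KEYPOLY term `T00e`. -/
def eLq_T00e : Expr :=
  (Expr.mul (Expr.add (Expr.var 0) (Expr.num 1)) (Expr.mul (Expr.add (Expr.var 0) (Expr.num 1)) (Expr.mul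
  (Expr.add (Expr.var 0) (Expr.neg (Expr.var 2))) (Expr.mul (Expr.add (Expr.mul (Expr.num (-2)) (Expr.var 0))
  (Expr.var 1)) (Expr.mul (Expr.add (Expr.add (Expr.var 0) (Expr.neg (Expr.var 2))) (Expr.num 1)) (Expr.mul
  (Expr.add (Expr.add (Expr.mul (Expr.num (-2)) (Expr.var 0)) (Expr.var 1)) (Expr.var 2)) (Expr.add (Expr.add
  (Expr.add (Expr.mul (Expr.num (-2)) (Expr.var 0)) (Expr.var 1)) (Expr.var 2)) (Expr.num (-2)))))))))

/-- `L / d` for the atom of KEYPOLY term `Tm1`. -/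
def eLq_Tm1 : Expr :=
  (Expr.mul (Expr.add (Expr.var 0) (Expr.num 1)) (Expr.mul (Expr.add (Expr.var 0) (Expr.num 1)) (Expr.mul
  (Expr.add (Expr.var 0) (Expr.neg (Expr.var 2))) (Expr.mul (Expr.add (Expr.add (Expr.var 0) (Expr.neg (Expr.var
  2))) (Expr.num 1)) (Expr.add (Expr.add (Expr.add (Expr.mul (Expr.num (-2)) (Expr.var 0)) (Expr.var 1))
  (Expr.var 2)) (Expr.num (-2)))))))

/-- `L / d` for the atom of KEYPOLY term `Tmm`. -/
def eLq_Tmm : Expr :=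
  (Expr.mul (Expr.num (-1)) (Expr.mul (Expr.add (Expr.var 0) (Expr.num 1)) (Expr.mul (Expr.add (Expr.var 0)
  (Expr.num 1)) (Expr.mul (Expr.add (Expr.mul (Expr.num (-2)) (Expr.var 0)) (Expr.var 1)) (Expr.mul (Expr.add
  (Expr.add (Expr.var 0) (Expr.neg (Expr.var 2))) (Expr.num 1)) (Expr.add (Expr.add (Expr.add (Expr.mul
  (Expr.num (-2)) (Expr.var 0)) (Expr.var 1)) (Expr.var 2)) (Expr.num (-2))))))))

/-- `L / d` for the atom of KEYPOLY term `Tzm`. -/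
def eLq_Tzm : Expr :=
  (Expr.mul (Expr.num (-1)) (Expr.mul (Expr.add (Expr.var 0) (Expr.num 1)) (Expr.mul (Expr.add (Expr.var 0)
  (Expr.num 1)) (Expr.mul (Expr.add (Expr.mul (Expr.num (-2)) (Expr.var 0)) (Expr.var 1)) (Expr.mul (Expr.add
  (Expr.add (Expr.var 0) (Expr.neg (Expr.var 2))) (Expr.num 1)) (Expr.mul (Expr.add (Expr.add (Expr.mul
  (Expr.num (-2)) (Expr.var 0)) (Expr.var 1)) (Expr.var 2)) (Expr.add (Expr.add (Expr.add (Expr.mul (Expr.num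
  (-2)) (Expr.var 0)) (Expr.var 1)) (Expr.var 2)) (Expr.num (-2)))))))))

/-- `L / d` for the atom of KEYPOLY term `S0t`. -/
def eLq_S0t : Expr :=
  (Expr.mul (Expr.add (Expr.var 0) (Expr.num 1)) (Expr.mul (Expr.add (Expr.var 0) (Expr.num 1)) (Expr.mul
  (Expr.add (Expr.var 0) (Expr.neg (Expr.var 2))) (Expr.mul (Expr.add (Expr.mul (Expr.num (-2)) (Expr.var 0))
  (Expr.var 1)) (Expr.mul (Expr.add (Expr.add (Expr.var 0) (Expr.neg (Expr.var 2))) (Expr.num 1)) (Expr.mul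
  (Expr.add (Expr.add (Expr.mul (Expr.num (-2)) (Expr.var 0)) (Expr.var 1)) (Expr.var 2)) (Expr.add (Expr.add
  (Expr.add (Expr.mul (Expr.num (-2)) (Expr.var 0)) (Expr.var 1)) (Expr.var 2)) (Expr.num (-2)))))))))

/-- `L / d` for the atom of KEYPOLY term `S1t`. -/
def eLq_S1t : Expr :=
  (Expr.mul (Expr.add (Expr.var 0) (Expr.num 1)) (Expr.mul (Expr.add (Expr.var 0) (Expr.num 1)) (Expr.mul
  (Expr.add (Expr.var 0) (Expr.neg (Expr.var 2))) (Expr.mul (Expr.add (Expr.mul (Expr.num (-2)) (Expr.var 0))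
  (Expr.var 1)) (Expr.mul (Expr.add (Expr.add (Expr.var 0) (Expr.neg (Expr.var 2))) (Expr.num 1)) (Expr.mul
  (Expr.add (Expr.add (Expr.mul (Expr.num (-2)) (Expr.var 0)) (Expr.var 1)) (Expr.var 2)) (Expr.add (Expr.add
  (Expr.add (Expr.mul (Expr.num (-2)) (Expr.var 0)) (Expr.var 1)) (Expr.var 2)) (Expr.num (-2)))))))))

/-- **NK key**: on the region `x < 0`, `0 ≤ k ≤ n−1` (`n ≥ 2`), the cleared termwise combination of the R-NK
certificate vanishes provided the two coordinate identities hold for the data values `E10,…,S1p`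
(they do: `fin0`, `fin1` with `E10 = e10 n x`, …, `S1p = PR1 n x (k+1)`). Atoms: `U = T(n+1;p+3,q+2)`, `T(n;p+i,q+j)` with
`p = 3n−x−k`, `q = 2n−k`. -/
theorem NK_key (n : ℕ) (hn : 2 ≤ n) (x k : ℚ) (hx : x < 0) (hk0 : 0 ≤ k) (hk : k + 1 ≤ (n : ℚ))
    (E10 E00 E01 S0 S1 S0p S1p : ℚ)
    (hfin0 : peval eF0_E10 [(n : ℚ), x, k] * E10 + peval eF0_E00 [(n : ℚ), x, k] * E00 + peval eF0_E01 [(n : ℚ), x, k] *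
      E01 + peval eF0_S0 [(n : ℚ), x, k] * S0 + peval eF0_S0p [(n : ℚ), x, k] * S0p + peval eF0_S1p [(n :
      ℚ), x, k] * S1p = 0)
    (hfin1 : peval eF1_E10 [(n : ℚ), x, k] * E10 + peval eF1_E01 [(n : ℚ), x, k] * E01 + peval eF1_S1 [(n : ℚ), x, k] *
      S1 + peval eF1_S0p [(n : ℚ), x, k] * S0p + peval eF1_S1p [(n : ℚ), x, k] * S1p = 0) :
    peval eK_U [(n : ℚ), x, k] * E10 * T (n + 1) ((3 * (n : ℚ) - x - k) + 3) ((2 * (n : ℚ) - k) + 2) + peval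
      eK_T00e [(n : ℚ), x, k] * E00 * T n (3 * (n : ℚ) - x - k) (2 * (n : ℚ) - k) + peval eK_Tm1 [(n : ℚ),
      x, k] * E01 * T n ((3 * (n : ℚ) - x - k) - 1) (2 * (n : ℚ) - k) + peval eK_Tmm [(n : ℚ), x, k] * S0p *
      T n ((3 * (n : ℚ) - x - k) - 1) ((2 * (n : ℚ) - k) - 1) + peval eK_Tzm [(n : ℚ), x, k] * S1p * T n (3
      * (n : ℚ) - x - k) ((2 * (n : ℚ) - k) - 1) + peval eK_S0t [(n : ℚ), x, k] * S0 * T n (3 * (n : ℚ) - x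
      - k) (2 * (n : ℚ) - k) + peval eK_S1t [(n : ℚ), x, k] * S1 * T n ((3 * (n : ℚ) - x - k) + 1) (2 * (n :
      ℚ) - k) = 0 := by
  have hn' : (2 : ℚ) ≤ n := by exact_mod_cast hn
  have d0 : pvar [(n : ℚ), x, k] 0 = (n : ℚ) := rfl
  have d1 : pvar [(n : ℚ), x, k] 1 = x := rfl
  have d2 : pvar [(n : ℚ), x, k] 2 = k := rfl
  have lq_U := peval_eq_of_kron (Expr.mul eLq_U eD_U) eL_NK (by decide +kernel) (by decide +kernel) (n : ℚ) x k
  have c_U := coord_U n hn x k hx hk0 hk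
  have p0_U := peval_eq_of_kron (Expr.mul eK_U (Expr.mul eLq_U eC0_U)) (Expr.mul eGcd0 eF0_E10) (by decide +kernel) (by decide +kernel) (n : ℚ) x k
  have p1_U := peval_eq_of_kron (Expr.mul eK_U (Expr.mul eLq_U eC1_U)) (Expr.mul eGcd1 eF1_E10) (by decide +kernel) (by decide +kernel) (n : ℚ) x k
  have lq_T00e := peval_eq_of_kron eLq_T00e eL_NK (by decide +kernel) (by decide +kernel) (n : ℚ) x k
  have p0_T00e := peval_eq_of_kron (Expr.mul eK_T00e eLq_T00e) (Expr.mul eGcd0 eF0_E00) (by decide +kernel) (by decide +kernel) (n : ℚ) x k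
  have lq_Tm1 := peval_eq_of_kron (Expr.mul eLq_Tm1 eD_Tm10) eL_NK (by decide +kernel) (by decide +kernel) (n : ℚ) x k
  have c_Tm1 := coord_Tm10 n hn x k hx hk0 hk
  have p0_Tm1 := peval_eq_of_kron (Expr.mul eK_Tm1 (Expr.mul eLq_Tm1 eC0_Tm10)) (Expr.mul eGcd0 eF0_E01) (by decide +kernel) (by decide +kernel) (n : ℚ) x k
  have p1_Tm1 := peval_eq_of_kron (Expr.mul eK_Tm1 (Expr.mul eLq_Tm1 eC1_Tm10)) (Expr.mul eGcd1 eF1_E01) (by decide +kernel) (by decide +kernel) (n : ℚ) x k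
  have lq_Tmm := peval_eq_of_kron (Expr.mul eLq_Tmm eD_Tm1m1) eL_NK (by decide +kernel) (by decide +kernel) (n : ℚ) x k
  have c_Tmm := coord_Tm1m1 n hn x k hx hk0 hk
  have p0_Tmm := peval_eq_of_kron (Expr.mul eK_Tmm (Expr.mul eLq_Tmm eC0_Tm1m1)) (Expr.mul eGcd0 eF0_S0p) (by decide +kernel) (by decide +kernel) (n : ℚ) x k
  have p1_Tmm := peval_eq_of_kron (Expr.mul eK_Tmm (Expr.mul eLq_Tmm eC1_Tm1m1)) (Expr.mul eGcd1 eF1_S0p) (by decide +kernel) (by decide +kernel) (n : ℚ) x k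
  have lq_Tzm := peval_eq_of_kron (Expr.mul eLq_Tzm eD_T0m1) eL_NK (by decide +kernel) (by decide +kernel) (n : ℚ) x k
  have c_Tzm := coord_T0m1 n hn x k hx hk0 hk
  have p0_Tzm := peval_eq_of_kron (Expr.mul eK_Tzm (Expr.mul eLq_Tzm eC0_T0m1)) (Expr.mul eGcd0 eF0_S1p) (by decide +kernel) (by decide +kernel) (n : ℚ) x k
  have p1_Tzm := peval_eq_of_kron (Expr.mul eK_Tzm (Expr.mul eLq_Tzm eC1_T0m1)) (Expr.mul eGcd1 eF1_S1p) (by decide +kernel) (by decide +kernel) (n : ℚ) x k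
  have lq_S0t := peval_eq_of_kron eLq_S0t eL_NK (by decide +kernel) (by decide +kernel) (n : ℚ) x k
  have p0_S0t := peval_eq_of_kron (Expr.mul eK_S0t eLq_S0t) (Expr.mul eGcd0 eF0_S0) (by decide +kernel) (by decide +kernel) (n : ℚ) x k
  have lq_S1t := peval_eq_of_kron eLq_S1t eL_NK (by decide +kernel) (by decide +kernel) (n : ℚ) x k
  have p1_S1t := peval_eq_of_kron (Expr.mul eK_S1t eLq_S1t) (Expr.mul eGcd1 eF1_S1) (by decide +kernel) (by decide +kernel) (n : ℚ) x k
  simp only [peval_mul] at lq_U p0_U p1_U lq_T00e p0_T00e lq_Tm1 p0_Tm1 p1_Tm1 lq_Tmm p0_Tmm p1_Tmm lq_Tzm p0_Tzm p1_Tzm lq_S0t p0_S0t lq_S1t p1_S1t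
  have hL : peval eL_NK [(n : ℚ), x, k] ≠ 0 := by
    simp only [eL_NK, peval_add, peval_neg, peval_mul, peval_num, peval_var, d0, d1, d2]
    push_cast
    exact (mul_ne_zero (ne_of_gt (by linarith)) (mul_ne_zero (ne_of_gt (by linarith)) (mul_ne_zero (ne_of_gt (by linarith)) (mul_ne_zero (ne_of_lt (by linarith)) (mul_ne_zero (ne_of_gt (by linarith)) (mul_ne_zero (ne_of_lt (by linarith)) (ne_of_lt (by linarith))))))))
  have key : peval eL_NK [(n : ℚ), x, k] * (peval eK_U [(n : ℚ), x, k] * E10 * T (n + 1) ((3 * (n : ℚ) - x - k) + 3) ((2 * (n : ℚ) - k) + 2) + peval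
      eK_T00e [(n : ℚ), x, k] * E00 * T n (3 * (n : ℚ) - x - k) (2 * (n : ℚ) - k) + peval eK_Tm1 [(n : ℚ),
      x, k] * E01 * T n ((3 * (n : ℚ) - x - k) - 1) (2 * (n : ℚ) - k) + peval eK_Tmm [(n : ℚ), x, k] * S0p *
      T n ((3 * (n : ℚ) - x - k) - 1) ((2 * (n : ℚ) - k) - 1) + peval eK_Tzm [(n : ℚ), x, k] * S1p * T n (3
      * (n : ℚ) - x - k) ((2 * (n : ℚ) - k) - 1) + peval eK_S0t [(n : ℚ), x, k] * S0 * T n (3 * (n : ℚ) - x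
      - k) (2 * (n : ℚ) - k) + peval eK_S1t [(n : ℚ), x, k] * S1 * T n ((3 * (n : ℚ) - x - k) + 1) (2 * (n :
      ℚ) - k)) = 0 := by
    linear_combination (-(peval eK_U [(n : ℚ), x, k] * E10 * T (n + 1) ((3 * (n : ℚ) - x - k) + 3) ((2 * (n : ℚ) - k) + 2))) * lq_U + (peval eK_U [(n : ℚ), x, k] * E10 * peval eLq_U [(n : ℚ), x, k]) * c_U + (E10 * T n (3 * (n : ℚ) - x - k) (2 * (n : ℚ) - k)) * p0_U + (E10 * T n ((3 * (n : ℚ) - x - k) + 1) (2 * (n : ℚ) - k)) * p1_U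
    + (-(peval eK_T00e [(n : ℚ), x, k] * E00 * T n (3 * (n : ℚ) - x - k) (2 * (n : ℚ) - k))) * lq_T00e + (E00 * T n (3 * (n : ℚ) - x - k) (2 * (n : ℚ) - k)) * p0_T00e
    + (-(peval eK_Tm1 [(n : ℚ), x, k] * E01 * T n ((3 * (n : ℚ) - x - k) - 1) (2 * (n : ℚ) - k))) * lq_Tm1 + (peval eK_Tm1 [(n : ℚ), x, k] * E01 * peval eLq_Tm1 [(n : ℚ), x, k]) * c_Tm1 + (E01 * T n (3 * (n : ℚ) - x - k) (2 * (n : ℚ) - k)) * p0_Tm1 + (E01 * T n ((3 * (n : ℚ) - x - k) + 1) (2 * (n : ℚ) - k)) * p1_Tm1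
    + (-(peval eK_Tmm [(n : ℚ), x, k] * S0p * T n ((3 * (n : ℚ) - x - k) - 1) ((2 * (n : ℚ) - k) - 1))) * lq_Tmm + (peval eK_Tmm [(n : ℚ), x, k] * S0p * peval eLq_Tmm [(n : ℚ), x, k]) * c_Tmm + (S0p * T n (3 * (n : ℚ) - x - k) (2 * (n : ℚ) - k)) * p0_Tmm + (S0p * T n ((3 * (n : ℚ) - x - k) + 1) (2 * (n : ℚ) - k)) * p1_Tmm
    + (-(peval eK_Tzm [(n : ℚ), x, k] * S1p * T n (3 * (n : ℚ) - x - k) ((2 * (n : ℚ) - k) - 1))) * lq_Tzm + (peval eK_Tzm [(n : ℚ), x, k] * S1p * peval eLq_Tzm [(n : ℚ), x, k]) * c_Tzm + (S1p * T n (3 * (n : ℚ) - x - k) (2 * (n : ℚ) - k)) * p0_Tzm + (S1p * T n ((3 * (n : ℚ) - x - k) + 1) (2 * (n : ℚ) - k)) * p1_Tzm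
    + (-(peval eK_S0t [(n : ℚ), x, k] * S0 * T n (3 * (n : ℚ) - x - k) (2 * (n : ℚ) - k))) * lq_S0t + (S0 * T n (3 * (n : ℚ) - x - k) (2 * (n : ℚ) - k)) * p0_S0t
    + (-(peval eK_S1t [(n : ℚ), x, k] * S1 * T n ((3 * (n : ℚ) - x - k) + 1) (2 * (n : ℚ) - k))) * lq_S1t + (S1 * T n ((3 * (n : ℚ) - x - k) + 1) (2 * (n : ℚ) - k)) * p1_S1t
    + (peval eGcd0 [(n : ℚ), x, k] * T n (3 * (n : ℚ) - x - k) (2 * (n : ℚ) - k)) * hfin0 + (peval eGcd1 [(n : ℚ), x, k] * T n ((3 * (n : ℚ) - x - k) + 1) (2 * (n : ℚ) - k)) * hfin1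
  exact (mul_eq_zero.mp key).resolve_left hL

end VIMInner.NK

end Summit.KontsevichZagierPeriods.Zeta5Search.Certificates
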